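import Summits.QuantumAdvantage.AdviceFreeQNC0.AffBells29Shadow

/-!
# AffBells34 — COVER HARDNESS (g34): strategies that are polylog-juntas MODULO a set `W` of `≤ N/3` positions lose

Cell qa-qnc0, route DWalkThree (crux stmt-QuantumAdvantage-22907, working rung (NP₁) `AffBells26.AffBellsPolyLoss3`).  AUTHORED AND PROVED BY
THE PLANNER SEAT qa-qnc0-p1 g34 (`HOME/qa-qnc0-p1/exp34/CoverHard34.lean`, farm rc 0 / 0 sorry); landed verbatim by qn-prover-3 g19 (ask P-35b,
ROUND-33 §E′ / ROUND-34 §9: `affCoverPolylogHard` = the hypothesis `AffCoverPolylogHardC` of `polyLoss_of_ocaCorePL`, load-bearing).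
WHAT THIS IS NOT: no crux closed; separation NOT moved.

The TREE theorem `AffBells23.ringHardOddCond2` (from `walkHardAllSubcube`, qn-lit g24 / prover landings) is MUCH stronger than the
`δ₀ = 0` instance `AffBells29.juntaLogHard` used so far: it allows an arbitrary set `W` of up to `δ₀·N` (`δ₀ < 1/2`) input positions on
which the outputs may depend ARBITRARILY, as long as on every subcube `{x|_W = a}` each output is a polylog-degree function of the free
bits.  For affine bell strategies this gives, with NO exponential sums:

* `coverPolylogHard`  — tables `g_k` reading `T_k` with `|T_k \ W| ≤ (log₂N)^C`, `3|W| ≤ N` ⇒ `winCount ≤ θ·2^{N−1}` (one absolute `θ<1`);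
* `affCoverPolylogHard` — rows `β_b` with `|supp β_b \ W| ≤ (log₂N)^C`, `3|W| ≤ N` ⇒ `affWinCard β c ≤ θ·2^{N−1}`;
* `hubCover_loses` — (W-hub) for hubs of width `≤ N/3` and POLYLOG perturbations: every row within Hamming distance `(log₂N)^C` of a
  multiple of one `h` with `3|supp h| ≤ N` ⇒ `affWinCard β c ≤ θ·2^{N−1}` (P-34a for `|supp h| ≤ N/3`, any `r ≤ (log₂ N)^C`);
  several hubs: take `W = ⋃ supp h_c` in `affCoverPolylogHard`.

So the «quasi-polynomial hub width» residual of ROUND-32 §6 ADD. 3–4 is EMPTY: hub width `≤ N/3` is covered here, width `≥ N^α` by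
frame domination + P-34d.  What this does NOT cover: perturbations of size `> polylog` outside `W` (the engine `Subcube.card_win_ext_le`
works at degree `√(free bits)`; a `√N`-version of `ringHardOddCond2` is ask P-35a), and configurations whose wide parts cannot be covered by
`N/3` positions (macroscopic drift components; many far-apart wide hubs — exp-sum side).
-/

noncomputable section

open Classical

namespace Summit.QuantumAdvantage.AdviceFreeQNC0.AffBells34

open Finset Literature.Computability.QuantumComplexity Literature.Computability.QuantumComplexity.RingHLF
open Literature.Computability.MetaComplexity Literature.Computability.MetaComplexity.Smolensky
open AffBells22 AffBells23 AffBells29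

variable {N : ℕ}

/-- `g ∘ subcubeMerge W a` reads only `T \ W` when `g` reads only `T`. -/
theorem readsOnly_subcubeMerge (W T : Finset (Fin N)) (a : Fin N → Bool) (g : (Fin N → Bool) → Bool)
    (hg : ReadsOnly T g) : ReadsOnly (T \ W) (fun x => g (subcubeMerge W a x)) := by
  intro x x' h
  apply hg
  intro i hi
  unfold subcubeMerge
  by_cases hiW : i ∈ W
  · simp [hiW]
  · simp only [hiW, if_false]
    exact h i (mem_sdiff.2 ⟨hi, hiW⟩)

/-- **COVER HARDNESS (tables).**  One absolute `θ < 1`: for every `C`, for `N ≥ n₀(C)`, for every set `W` with `3|W| ≤ N`, a strategy whose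
`k`-th output reads a set `T_k` with `|T_k \ W| ≤ (log₂ N)^C` (arbitrary dependence on the bits in `W`) wins on at most `θ·2^{N−1}` odd inputs. -/
theorem coverPolylogHard : ∃ θ : ℝ, θ < 1 ∧ ∀ C : ℕ, ∃ n₀ : ℕ, ∀ N ≥ n₀,
    ∀ (W : Finset (Fin N)) (T : Fin N → Finset (Fin N)) (g : Fin N → (Fin N → Bool) → Bool),
      3 * W.card ≤ N → (∀ k, (T k \ W).card ≤ (Nat.log 2 N) ^ C) → (∀ k, ReadsOnly (T k) (g k)) →
        (winCount (fun x k => g k x) : ℝ) ≤ θ * (2 : ℝ) ^ (N - 1) := by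
  obtain ⟨θ, hθ, hall⟩ := ringHardOddCond2 (δ₀ := 1 / 3) (by norm_num)
  refine ⟨θ, hθ, fun C => ?_⟩
  obtain ⟨n₀, hn₀⟩ := hall C
  refine ⟨n₀, fun N hN W T g hW hT hread => ?_⟩
  set P : Fin N → CubeFn (ZMod 2) N := fun k x => if g k x then 1 else 0 with hP
  have hdeg : ∀ (a : Fin N → Bool) (k : Fin N),
      (fun x => P k (subcubeMerge W a x)) ∈ lowDeg (ZMod 2) N ((Nat.log 2 N) ^ C) := by
    intro a k
    have hfun : (fun x => P k (subcubeMerge W a x)) =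
        fun x => if (fun x => g k (subcubeMerge W a x)) x then (1 : ZMod 2) else 0 := rfl
    rw [hfun]
    exact lowDeg_mono (hT k) (indicator_mem_lowDeg (T k \ W) _ (readsOnly_subcubeMerge W (T k) a (g k) (hread k)))
  have hW' : (W.card : ℝ) ≤ 1 / 3 * N := by
    have h3 : ((3 * W.card : ℕ) : ℝ) ≤ (N : ℝ) := by exact_mod_cast hW
    push_cast at h3
    linarith
  have h := hn₀ N hN W P hW' hdeg
  have hfun : ∀ x : Fin N → Bool, (fun i => decide (P i x = 1)) = fun k => g k x := by
    intro x
    funext k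
    simp only [hP]
    by_cases hgk : g k x = true
    · simp [hgk]
    · simp [hgk]
  have hset : ((univ : Finset (Fin N → Bool)).filter fun x => OddZeros x ∧ Rel x (fun k => g k x))
      = (univ : Finset (Fin N → Bool)).filter fun x => OddZeros x ∧ Rel x (fun i => decide (P i x = 1)) := by
    ext x
    simp only [mem_filter, hfun x]
  unfold AffBells22.winCount
  rw [hset]
  exact h

/-- **COVER HARDNESS (affine bells).**  `3|W| ≤ N` and every row supported in `W` up to `(log₂ N)^C` positions ⇒ `affWinCard β c ≤ θ·2^{N−1}`. -/
theorem affCoverPolylogHard : ∃ θ : ℝ, θ < 1 ∧ ∀ C : ℕ, ∃ n₀ : ℕ, ∀ N ≥ n₀,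
    ∀ (β : Fin N → Fin N → ZMod 3) (c : Fin N → ZMod 3) (W : Finset (Fin N)),
      3 * W.card ≤ N → (∀ b, (rowSupp β b \ W).card ≤ (Nat.log 2 N) ^ C) →
        (affWinCard β c : ℝ) ≤ θ * (2 : ℝ) ^ (N - 1) := by
  obtain ⟨θ, hθ, hall⟩ := coverPolylogHard
  refine ⟨θ, hθ, fun C => ?_⟩
  obtain ⟨n₀, hn₀⟩ := hall C
  refine ⟨n₀, fun N hN β c W hW hrows => ?_⟩
  rw [affWinCard_eq_winCount]
  exact hn₀ N hN W (fun b => rowSupp β b) (fun b x => affBell β c x b) hW hrows (fun b => readsOnly_affBell β c b)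

/-- the support of a vector `h : Fin N → ZMod 3`. -/
def vsupp (h : Fin N → ZMod 3) : Finset (Fin N) := univ.filter fun i => h i ≠ 0

/-- a row within Hamming distance `r` of `m·h` is supported in `supp h` up to `r` positions. -/
theorem card_rowSupp_sdiff_vsupp_le (β : Fin N → Fin N → ZMod 3) (b : Fin N) (h : Fin N → ZMod 3) (m : ZMod 3) :
    (rowSupp β b \ vsupp h).card ≤ (univ.filter fun i => β b i ≠ m * h i).card := by
  apply card_le_card
  intro i hi
  rw [mem_sdiff, rowSupp, mem_filter, vsupp, mem_filter] at hi
  obtain ⟨⟨_, hβ⟩, hh⟩ := hi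
  have hh0 : h i = 0 := by
    by_contra hne
    exact hh ⟨mem_univ _, hne⟩
  rw [mem_filter]
  refine ⟨mem_univ _, ?_⟩
  rw [hh0, mul_zero]
  exact hβ

/-- **(W-hub) for hubs of width `≤ N/3`, polylog perturbations (P-34a in that range, PROVED).**  Every row within Hamming distance
`(log₂ N)^C` of SOME multiple (possibly `0`) of one vector `h` with `3|supp h| ≤ N` ⇒ `affWinCard β c ≤ θ·2^{N−1}`. -/
theorem hubCover_loses : ∃ θ : ℝ, θ < 1 ∧ ∀ C : ℕ, ∃ n₀ : ℕ, ∀ N ≥ n₀,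
    ∀ (β : Fin N → Fin N → ZMod 3) (c : Fin N → ZMod 3),
      (∃ h : Fin N → ZMod 3, 3 * (vsupp h).card ≤ N ∧
          ∀ b, ∃ m : ZMod 3, (univ.filter fun i => β b i ≠ m * h i).card ≤ (Nat.log 2 N) ^ C) →
        (affWinCard β c : ℝ) ≤ θ * (2 : ℝ) ^ (N - 1) := by
  obtain ⟨θ, hθ, hall⟩ := affCoverPolylogHard
  refine ⟨θ, hθ, fun C => ?_⟩
  obtain ⟨n₀, hn₀⟩ := hall C
  refine ⟨n₀, fun N hN β c ⟨h, hh, hrows⟩ => hn₀ N hN β c (vsupp h) hh fun b => ?_⟩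
  obtain ⟨m, hm⟩ := hrows b
  exact (card_rowSupp_sdiff_vsupp_le β b h m).trans hm

/-- **Multi-hub form.**  Rows within `(log₂ N)^C` of multiples of hubs `h₁ … h_m` whose supports together occupy `≤ N/3` positions lose. -/
theorem multiHubCover_loses : ∃ θ : ℝ, θ < 1 ∧ ∀ C : ℕ, ∃ n₀ : ℕ, ∀ N ≥ n₀,
    ∀ (β : Fin N → Fin N → ZMod 3) (c : Fin N → ZMod 3) (m : ℕ) (V : Fin m → Fin N → ZMod 3),
      3 * (univ.biUnion fun l => vsupp (V l)).card ≤ N →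
      (∀ b, ∃ l : Fin m, ∃ t : ZMod 3, (univ.filter fun i => β b i ≠ t * V l i).card ≤ (Nat.log 2 N) ^ C) →
        (affWinCard β c : ℝ) ≤ θ * (2 : ℝ) ^ (N - 1) := by
  obtain ⟨θ, hθ, hall⟩ := affCoverPolylogHard
  refine ⟨θ, hθ, fun C => ?_⟩
  obtain ⟨n₀, hn₀⟩ := hall C
  refine ⟨n₀, fun N hN β c m V hU hrows => hn₀ N hN β c _ hU fun b => ?_⟩
  obtain ⟨l, t, ht⟩ := hrows b
  refine le_trans (card_le_card ?_) ((card_rowSupp_sdiff_vsupp_le β b (V l) t).trans ht)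
  intro i hi
  rw [mem_sdiff] at hi ⊢
  refine ⟨hi.1, fun hmem => hi.2 ?_⟩
  exact mem_biUnion.2 ⟨l, mem_univ _, hmem⟩

end Summit.QuantumAdvantage.AdviceFreeQNC0.AffBells34
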